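import Literature.Geometry.Lorentzian.MomentChainSplit
import Literature.Geometry.Lorentzian.AnnulusStarCover
import Literature.Geometry.Lorentzian.BogovskiiLemma23
import Literature.Geometry.Lorentzian.BogovskiiH2Bound
import Mathlib.Geometry.Manifold.PartitionOfUnity
import Mathlib.Analysis.Calculus.BumpFunction.Normed
import HarnessLib

/-!
# A linear Bogovskiĭ-type operator on the annulus `A₁` with `L² → H²` bounds (Mao–Oh–Tao's Lemma 2.2 for `S`)

(trunk G08 = T-LORENTZ; family `gr`; namespace `Literature.Geometry.Lorentzian.MaoOhTao`.)

Mao–Oh–Tao (arXiv:2308.13031), Lemma 2.2 (p. 8) and its proof (p. 9).  `BogovskiiAnnulus.lean` records (S1)–(S2) on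
`A₁ = {1 < r < 2}` in weak, per-density form only.  Here the operator is made LINEAR with FIXED cut-offs, as in the
paper, and the `L²`-level mapping property (S3) is added:

* geometry: a closed walk `walkDir 0, …, walkDir 15` through the fourteen sector directions of `AnnulusStarCover`
  (signed axes and corners alternate; consecutive sectors share the witness point `walkPt k`), the direction cones
  `dirCone ω ⊇ annSector ω`, and a smooth partition of unity `annulusCutoff k` (`k < 16`) on the closed shell
  `{1 ≤ r ≤ 2}` subordinate to the cones (Mathlib's `SmoothPartitionOfUnity`);
* bumps: `annulusBump k` at `walkPt k` inside `annSector (walkDir k) ∩ annSector (walkDir (k-1))`, and normalised kernel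
  bumps `kernelBump k` (`∫ = 1`) in the ball of radius `1/20` about `(3/2) walkDir k/|walkDir k|`, with respect to which
  the sector is star-shaped (`starConvex_annSector`);
* the operator `annulusS f = Σ_{k<16} S_{kernelBump k} (chainPiece annulusCutoff annulusBump 15 f k)`
  (`MomentChainSplit`: the pieces are linear in `f`, supported in the sectors, moment-free for moment-free `f`);
* results: `annulusS_add_smul` (linearity on `C_c`), `support_annulusS_subset` ((S1): `supp S f ⊆ A₁`),
  `contDiff_two_annulusS`, `sum_sum_pd_pd_annulusS_eq` ((S2): `∂_i∂_j (S f)^{ij} = f` pointwise for moment-free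
  `f ∈ C²_c(A₁)`), `exists_l2Const_annulusPiece` and `exists_sobolevConst_annulusS` ((S3) at the `L²` level:
  `∫|S f|², ∫|∂S f|², ∫|∂²S f|² ≤ C∫|f|²`, from the landed `L²`, `Ḣ¹`, `Ḣ²` bounds for `S_η` on star-shaped sets).

`TODO(general form)`: the full scale `H^{s'-2} → H^{s'}` and the commutator bound (S4); the vector operator `T`.

## References

* Y. Mao, S.-J. Oh, T. Tao, arXiv:2308.13031 (2023), Lemma 2.2 and its proof, pp. 8–9 (key `MaoOhTao2023`).
-/

noncomputable section

open scoped RealInnerProductSpace Topology ENNReal Manifold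
open Filter MeasureTheory Set Metric Function

namespace Literature.Geometry.Lorentzian

namespace MaoOhTao

/-! ### Direction cones and the walk through the fourteen sectors -/

/-- The open cone of aperture `arccos(18/25)` about `ω`. [folklore] -/
def dirCone (ω : E3) : Set E3 := {x | (18 / 25 : ℝ) * (‖x‖ * ‖ω‖) < ⟪x, ω⟫}

/-- The cone is open. [folklore] -/
theorem isOpen_dirCone (ω : E3) : IsOpen (dirCone ω) :=
  isOpen_lt (continuous_const.mul (continuous_norm.mul continuous_const)) (continuous_id.inner continuous_const)

/-- `annSector ω = A₁ ∩ dirCone ω`. [folklore] -/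
theorem annSector_eq_inter (ω : E3) : annSector ω = {x : E3 | 1 < ‖x‖ ∧ ‖x‖ < 2} ∩ dirCone ω := by
  ext x
  simp only [mem_annSector, mem_inter_iff, mem_setOf_eq, dirCone, and_assoc]

/-- Cone membership is invariant under positive scaling. [folklore] -/
theorem smul_mem_dirCone_iff {ω x : E3} {c : ℝ} (hc : 0 < c) : c • x ∈ dirCone ω ↔ x ∈ dirCone ω := by
  simp only [dirCone, mem_setOf_eq, norm_smul, Real.norm_eq_abs, abs_of_pos hc, inner_smul_left, RCLike.conj_to_real]
  constructor
  · intro h; nlinarith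
  · intro h; nlinarith

/-- **The walk** through the fourteen directions (signed axes and corners alternate; `+e₀` and `−e₁` are visited
twice): consecutive sectors intersect. [folklore] -/
def walkDir : ℕ → E3
  | 0 => axis 0 true
  | 1 => corner ![true, true, true]
  | 2 => axis 1 true
  | 3 => corner ![false, true, true]
  | 4 => axis 2 true
  | 5 => corner ![true, false, true]
  | 6 => axis 1 false
  | 7 => corner ![false, false, true]
  | 8 => axis 0 false
  | 9 => corner ![false, true, false]
  | 10 => axis 2 false
  | 11 => corner ![true, true, false]
  | 12 => axis 0 true
  | 13 => corner ![true, false, false]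
  | 14 => axis 1 false
  | 15 => corner ![false, false, false]
  | _ => axis 0 true

/-- **The shared witness points**: `walkPt k ∈ annSector (walkDir k) ∩ annSector (walkDir (k − 1))` for `1 ≤ k ≤ 15`.
[folklore] -/
def walkPt : ℕ → E3
  | 1 => wpt 0 ![true, true, true]
  | 2 => wpt 1 ![true, true, true]
  | 3 => wpt 1 ![false, true, true]
  | 4 => wpt 2 ![false, true, true]
  | 5 => wpt 2 ![true, false, true]
  | 6 => wpt 1 ![true, false, true]
  | 7 => wpt 1 ![false, false, true]
  | 8 => wpt 0 ![false, false, true]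
  | 9 => wpt 0 ![false, true, false]
  | 10 => wpt 2 ![false, true, false]
  | 11 => wpt 2 ![true, true, false]
  | 12 => wpt 0 ![true, true, false]
  | 13 => wpt 0 ![true, false, false]
  | 14 => wpt 1 ![true, false, false]
  | 15 => wpt 1 ![false, false, false]
  | _ => wpt 0 ![true, true, true]

/-- Every walk direction is a signed axis or a corner; in particular it is nonzero. [folklore] -/
theorem walkDir_ne_zero (k : ℕ) : walkDir k ≠ 0 := by
  have hax : ∀ (i : Fin 3) (b : Bool), axis i b ≠ 0 := fun i b h ↦ by
    have := norm_axis i b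
    rw [h, norm_zero] at this
    exact zero_ne_one this
  have hco : ∀ s, corner s ≠ 0 := fun s h ↦ by
    have := norm_corner_sq s
    rw [h, norm_zero] at this
    norm_num at this
  match k with
  | 0 | 2 | 4 | 6 | 8 | 10 | 12 | 14 => exact hax _ _
  | 1 | 3 | 5 | 7 | 9 | 11 | 13 | 15 => exact hco _
  | n + 16 => exact hax _ _

/-- **Chain property of the walk**: the shared point lies in both consecutive sectors (`1 ≤ k ≤ 15`). [folklore] -/
theorem walkPt_mem (k : ℕ) (hk1 : 1 ≤ k) (hk : k ≤ 15) :
    walkPt k ∈ annSector (walkDir k) ∧ walkPt k ∈ annSector (walkDir (k - 1)) := by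
  interval_cases k
  · exact ⟨wpt_mem_annSector_corner 0 _, wpt_mem_annSector_axis 0 ![true, true, true]⟩
  · exact ⟨wpt_mem_annSector_axis 1 ![true, true, true], wpt_mem_annSector_corner 1 _⟩
  · exact ⟨wpt_mem_annSector_corner 1 _, wpt_mem_annSector_axis 1 ![false, true, true]⟩
  · exact ⟨wpt_mem_annSector_axis 2 ![false, true, true], wpt_mem_annSector_corner 2 _⟩
  · exact ⟨wpt_mem_annSector_corner 2 _, wpt_mem_annSector_axis 2 ![true, false, true]⟩
  · exact ⟨wpt_mem_annSector_axis 1 ![true, false, true], wpt_mem_annSector_corner 1 _⟩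
  · exact ⟨wpt_mem_annSector_corner 1 _, wpt_mem_annSector_axis 1 ![false, false, true]⟩
  · exact ⟨wpt_mem_annSector_axis 0 ![false, false, true], wpt_mem_annSector_corner 0 _⟩
  · exact ⟨wpt_mem_annSector_corner 0 _, wpt_mem_annSector_axis 0 ![false, true, false]⟩
  · exact ⟨wpt_mem_annSector_axis 2 ![false, true, false], wpt_mem_annSector_corner 2 _⟩
  · exact ⟨wpt_mem_annSector_corner 2 _, wpt_mem_annSector_axis 2 ![true, true, false]⟩
  · exact ⟨wpt_mem_annSector_axis 0 ![true, true, false], wpt_mem_annSector_corner 0 _⟩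
  · exact ⟨wpt_mem_annSector_corner 0 _, wpt_mem_annSector_axis 0 ![true, false, false]⟩
  · exact ⟨wpt_mem_annSector_axis 1 ![true, false, false], wpt_mem_annSector_corner 1 _⟩
  · exact ⟨wpt_mem_annSector_corner 1 _, wpt_mem_annSector_axis 1 ![false, false, false]⟩

/-- Every corner direction occurs in the walk. [folklore] -/
theorem exists_walkDir_eq_corner (s : Fin 3 → Bool) : ∃ k : Fin 16, walkDir k = corner s := by
  have hs : s = ![s 0, s 1, s 2] := by
    funext j; fin_cases j <;> rfl
  rw [hs]
  cases s 0 <;> cases s 1 <;> cases s 2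
  · exact ⟨15, rfl⟩
  · exact ⟨7, rfl⟩
  · exact ⟨9, rfl⟩
  · exact ⟨3, rfl⟩
  · exact ⟨13, rfl⟩
  · exact ⟨5, rfl⟩
  · exact ⟨11, rfl⟩
  · exact ⟨1, rfl⟩

/-- Every signed axis direction occurs in the walk. [folklore] -/
theorem exists_walkDir_eq_axis (i : Fin 3) (b : Bool) : ∃ k : Fin 16, walkDir k = axis i b := by
  fin_cases i <;> cases b
  · exact ⟨8, rfl⟩
  · exact ⟨0, rfl⟩
  · exact ⟨6, rfl⟩
  · exact ⟨2, rfl⟩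
  · exact ⟨10, rfl⟩
  · exact ⟨4, rfl⟩

/-- **Covering**: every nonzero point lies in one of the sixteen cones. [folklore] -/
theorem exists_mem_dirCone_walkDir (x : E3) (hx : x ≠ 0) : ∃ k : Fin 16, x ∈ dirCone (walkDir k) := by
  have hx0 : 0 < ‖x‖ := norm_pos_iff.2 hx
  set c : ℝ := (3 / 2 : ℝ) * ‖x‖⁻¹ with hc
  have hc0 : 0 < c := by positivity
  set x' : E3 := c • x with hx'
  have hn : ‖x'‖ = 3 / 2 := by
    rw [hx', norm_smul, Real.norm_eq_abs, abs_of_pos hc0, hc]; field_simp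
  have h1 : 1 < ‖x'‖ := by rw [hn]; norm_num
  have h2 : ‖x'‖ < 2 := by rw [hn]; norm_num
  have key : ∀ ω, x' ∈ annSector ω → x ∈ dirCone ω := fun ω h ↦ by
    rw [annSector_eq_inter] at h
    exact (smul_mem_dirCone_iff hc0).1 h.2
  rcases exists_mem_annSector x' h1 h2 with ⟨s, hs⟩ | ⟨i, s, hs⟩
  · obtain ⟨k, hk⟩ := exists_walkDir_eq_corner s
    exact ⟨k, hk ▸ key _ hs⟩
  · obtain ⟨k, hk⟩ := exists_walkDir_eq_axis i (s i)
    exact ⟨k, hk ▸ key _ hs⟩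

/-! ### The smooth partition of unity subordinate to the cones -/

/-- **Existence of the cut-offs**: smooth `φ_k` (`k < 16`), `0 ≤ φ_k ≤ 1`, `tsupp φ_k ⊆ dirCone (walkDir k)`,
`Σ_k φ_k = 1` on the closed shell `{1 ≤ r ≤ 2}`. [folklore] -/
theorem exists_annulusPartition :
    ∃ φ : Fin 16 → E3 → ℝ, (∀ k, ContDiff ℝ ((⊤ : ℕ∞) : WithTop ℕ∞) (φ k)) ∧ (∀ k x, 0 ≤ φ k x ∧ φ k x ≤ 1) ∧
      (∀ k, tsupport (φ k) ⊆ dirCone (walkDir k)) ∧ ∀ x : E3, 1 ≤ ‖x‖ → ‖x‖ ≤ 2 → ∑ k, φ k x = 1 := by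
  set s : Set E3 := {x | 1 ≤ ‖x‖ ∧ ‖x‖ ≤ 2} with hs
  have hsc : IsClosed s := (isClosed_le continuous_const continuous_norm).inter (isClosed_le continuous_norm continuous_const)
  have hU : s ⊆ ⋃ k : Fin 16, dirCone (walkDir k) := fun x hx ↦
    mem_iUnion.2 (exists_mem_dirCone_walkDir x (norm_pos_iff.1 (by linarith [hx.1])))
  obtain ⟨P, hP⟩ := SmoothPartitionOfUnity.exists_isSubordinate (I := 𝓘(ℝ, E3)) hsc (fun k : Fin 16 ↦ dirCone (walkDir k))
    (fun k ↦ isOpen_dirCone _) hU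
  refine ⟨fun k x ↦ P k x, fun k ↦ ?_, fun k x ↦ ⟨P.nonneg k x, P.le_one k x⟩, fun k ↦ hP k, fun x hx1 hx2 ↦ ?_⟩
  · exact contMDiff_iff_contDiff.1 (P k).contMDiff
  · have h := P.sum_eq_one (x := x) ⟨hx1, hx2⟩
    rwa [finsum_eq_sum_of_fintype] at h

/-- **The cut-offs** `φ_k` of the annulus (zero for `k ≥ 16`). [folklore] -/
def annulusCutoff (k : ℕ) : E3 → ℝ :=
  if h : k < 16 then Classical.choose exists_annulusPartition ⟨k, h⟩ else 0

/-- The cut-offs are smooth. [folklore] -/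
theorem contDiff_annulusCutoff {n : ℕ∞} (k : ℕ) : ContDiff ℝ n (annulusCutoff k) := by
  unfold annulusCutoff
  split_ifs with h
  · exact ((Classical.choose_spec exists_annulusPartition).1 ⟨k, h⟩).of_le (by exact_mod_cast le_top)
  · exact contDiff_const

/-- The cut-offs are continuous. [folklore] -/
theorem continuous_annulusCutoff (k : ℕ) : Continuous (annulusCutoff k) :=
  (contDiff_annulusCutoff (n := 0) k).continuous

/-- `0 ≤ φ_k ≤ 1`. [folklore] -/
theorem annulusCutoff_mem_Icc (k : ℕ) (x : E3) : 0 ≤ annulusCutoff k x ∧ annulusCutoff k x ≤ 1 := by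
  unfold annulusCutoff
  split_ifs with h
  · exact (Classical.choose_spec exists_annulusPartition).2.1 ⟨k, h⟩ x
  · simp

/-- `|φ_k| ≤ 1`. [folklore] -/
theorem abs_annulusCutoff_le (k : ℕ) (x : E3) : |annulusCutoff k x| ≤ 1 := by
  obtain ⟨h0, h1⟩ := annulusCutoff_mem_Icc k x
  rw [abs_of_nonneg h0]; exact h1

/-- `tsupp φ_k ⊆ dirCone (walkDir k)`. [folklore] -/
theorem tsupport_annulusCutoff_subset (k : ℕ) : tsupport (annulusCutoff k) ⊆ dirCone (walkDir k) := by
  unfold annulusCutoff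
  split_ifs with h
  · exact (Classical.choose_spec exists_annulusPartition).2.2.1 ⟨k, h⟩
  · intro x hx
    simp at hx

/-- `Σ_{k<16} φ_k = 1` on the closed shell. [folklore] -/
theorem sum_annulusCutoff_eq_one {x : E3} (hx1 : 1 ≤ ‖x‖) (hx2 : ‖x‖ ≤ 2) :
    ∑ k ∈ Finset.range (15 + 1), annulusCutoff k x = 1 := by
  have h := (Classical.choose_spec exists_annulusPartition).2.2.2 x hx1 hx2
  rw [← h, Finset.sum_range (f := fun k ↦ annulusCutoff k x)]
  refine Finset.sum_congr rfl fun k _ ↦ ?_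
  simp only [annulusCutoff, dif_pos k.isLt]

/-! ### The bumps at the shared points and the kernel bumps -/

/-- A radius `ε_k > 0` with `B(walkPt k, ε_k) ⊆ annSector (walkDir k) ∩ annSector (walkDir (k-1))` (`1 ≤ k ≤ 15`;
`1` otherwise). [folklore] -/
theorem exists_ball_walkPt_subset (k : ℕ) : ∃ ε : ℝ, 0 < ε ∧ (1 ≤ k → k ≤ 15 →
    ball (walkPt k) ε ⊆ annSector (walkDir k) ∩ annSector (walkDir (k - 1))) := by
  by_cases hk : 1 ≤ k ∧ k ≤ 15
  · obtain ⟨h1, h2⟩ := walkPt_mem k hk.1 hk.2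
    obtain ⟨ε, hε, hball⟩ := Metric.isOpen_iff.1 ((isOpen_annSector _).inter (isOpen_annSector _)) (walkPt k) ⟨h1, h2⟩
    exact ⟨ε, hε, fun _ _ ↦ hball⟩
  · exact ⟨1, one_pos, fun h1 h2 ↦ (hk ⟨h1, h2⟩).elim⟩

/-- The radius of the `k`-th bump. [folklore] -/
def bumpRadius (k : ℕ) : ℝ := Classical.choose (exists_ball_walkPt_subset k)

/-- The radius is positive. [folklore] -/
theorem bumpRadius_pos (k : ℕ) : 0 < bumpRadius k := (Classical.choose_spec (exists_ball_walkPt_subset k)).1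

/-- The ball of the `k`-th bump lies in both consecutive sectors. [folklore] -/
theorem ball_bumpRadius_subset {k : ℕ} (hk1 : 1 ≤ k) (hk : k ≤ 15) :
    ball (walkPt k) (bumpRadius k) ⊆ annSector (walkDir k) ∩ annSector (walkDir (k - 1)) :=
  (Classical.choose_spec (exists_ball_walkPt_subset k)).2 hk1 hk

/-- The `k`-th bump as a `ContDiffBump`. [folklore] -/
def annulusBumpData (k : ℕ) : ContDiffBump (walkPt k) :=
  ⟨bumpRadius k / 4, bumpRadius k / 2, div_pos (bumpRadius_pos k) (by norm_num),
    by have := bumpRadius_pos k; linarith⟩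

/-- **The bumps** `η_k` at the shared points. [folklore] -/
def annulusBump (k : ℕ) : E3 → ℝ := fun x ↦ annulusBumpData k x

/-- The bumps are smooth. [folklore] -/
theorem contDiff_annulusBump {n : ℕ∞} (k : ℕ) : ContDiff ℝ n (annulusBump k) := (annulusBumpData k).contDiff

/-- The bumps are continuous. [folklore] -/
theorem continuous_annulusBump (k : ℕ) : Continuous (annulusBump k) := (annulusBumpData k).continuous

/-- The bumps have compact support. [folklore] -/
theorem hasCompactSupport_annulusBump (k : ℕ) : HasCompactSupport (annulusBump k) :=
  (annulusBumpData k).hasCompactSupport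

/-- The bump is `1` at its centre. [folklore] -/
theorem annulusBump_walkPt (k : ℕ) : annulusBump k (walkPt k) ≠ 0 := by
  have : annulusBump k (walkPt k) = 1 :=
    (annulusBumpData k).one_of_mem_closedBall (mem_closedBall_self (div_pos (bumpRadius_pos k) (by norm_num)).le)
  rw [this]; exact one_ne_zero

/-- The bumps vanish off both consecutive sectors (`1 ≤ k ≤ 15`). [folklore] -/
theorem annulusBump_eq_zero {k : ℕ} (hk1 : 1 ≤ k) (hk : k ≤ 15) {x : E3}
    (hx : x ∉ annSector (walkDir k) ∩ annSector (walkDir (k - 1))) : annulusBump k x = 0 := by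
  have ht : tsupport (annulusBump k) = closedBall (walkPt k) (bumpRadius k / 2) := (annulusBumpData k).tsupport_eq
  have hx' : x ∉ tsupport (annulusBump k) := by
    intro h
    rw [ht] at h
    refine hx (ball_bumpRadius_subset hk1 hk ((closedBall_subset_ball ?_) h))
    have := bumpRadius_pos k; linarith
  exact image_eq_zero_of_notMem_tsupport hx'

/-- The star centre `c_k = (3/2) walkDir k/|walkDir k|`. [folklore] -/
def starCentre (k : ℕ) : E3 := ((3 / 2 : ℝ) * ‖walkDir k‖⁻¹) • walkDir k

/-- `|c_k| = 3/2`. [folklore] -/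
theorem norm_starCentre (k : ℕ) : ‖starCentre k‖ = 3 / 2 := by
  have hn : 0 < ‖walkDir k‖ := norm_pos_iff.2 (walkDir_ne_zero k)
  rw [starCentre, norm_smul, Real.norm_eq_abs, abs_of_pos (by positivity)]
  field_simp

/-- The raw kernel bump about `c_k` (radii `1/80`, `1/40`). [folklore] -/
def kernelBumpData (k : ℕ) : ContDiffBump (starCentre k) := ⟨1 / 80, 1 / 40, by norm_num, by norm_num⟩

/-- **The normalised kernel bumps** `η̂_k = b_k/∫ b_k`. [folklore] -/
def kernelBump (k : ℕ) : E3 → ℝ := fun x ↦ kernelBumpData k x / ∫ y : E3, kernelBumpData k y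

/-- The kernel bumps are smooth. [folklore] -/
theorem contDiff_kernelBump {n : ℕ∞} (k : ℕ) : ContDiff ℝ n (kernelBump k) :=
  (kernelBumpData k).contDiff.div_const _

/-- `∫ η̂_k = 1`. [folklore] -/
theorem integral_kernelBump (k : ℕ) : ∫ x : E3, kernelBump k x = 1 := by
  simp only [kernelBump]
  rw [integral_div, div_self (kernelBumpData k).integral_pos.ne']

/-- The kernel bump vanishes off the ball of radius `1/40` about `c_k`; in particular `η̂_k ≠ 0 ⟹` in the ball of
radius `1/20`. [folklore] -/
theorem mem_ball_of_kernelBump_ne_zero (k : ℕ) {z : E3} (hz : kernelBump k z ≠ 0) :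
    z ∈ ball (starCentre k) (1 / 20) := by
  have h : kernelBumpData k z ≠ 0 := by
    intro h; apply hz; simp [kernelBump, h]
  have := (kernelBumpData k).support_eq ▸ (mem_support.2 h)
  exact ball_subset_ball (by show (1 / 40 : ℝ) ≤ 1 / 20; norm_num) this

/-- The kernel bump vanishes for `|z| > 2`. [folklore] -/
theorem kernelBump_eq_zero_of_lt (k : ℕ) (z : E3) (hz : 2 < ‖z‖) : kernelBump k z = 0 := by
  by_contra h
  have hb := mem_ball_of_kernelBump_ne_zero k h
  rw [mem_ball, dist_eq_norm] at hb
  have : ‖z‖ ≤ ‖z - starCentre k‖ + ‖starCentre k‖ := norm_le_norm_sub_add z (starCentre k)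
  rw [norm_starCentre] at this
  linarith

/-- The sector about `walkDir k` is star-shaped with respect to every point where `η̂_k ≠ 0`. [folklore] -/
theorem starConvex_of_kernelBump (k : ℕ) :
    ∀ b ∈ ball (starCentre k) (1 / 20), StarConvex ℝ b (annSector (walkDir k)) := fun _ hb ↦
  starConvex_annSector (walkDir_ne_zero k) hb

/-! ### The operator -/

/-- **The linear Bogovskiĭ-type operator on the annulus**:
`(S f)^{ij} = Σ_{k<16} S_{η̂_k}(f_k)^{ij}`, `f_k = chainPiece annulusCutoff annulusBump 15 f k`.
[cite: MaoOhTao2023, Lemma 2.2] -/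
def annulusS (f : E3 → ℝ) (i j : Fin 3) (x : E3) : ℝ :=
  ∑ k ∈ Finset.range (15 + 1), bogovskiiS (kernelBump k) (chainPiece annulusCutoff annulusBump 15 f k) i j x


/-! ### The pieces of a density supported in the annulus -/

section Pieces

variable {f g : E3 → ℝ}

/-- Shorthand: the open annulus `A₁`. [folklore] -/
theorem mem_annulus_of_mem_tsupport {f : E3 → ℝ} (hfA : tsupport f ⊆ {x : E3 | 1 < ‖x‖ ∧ ‖x‖ < 2}) {y : E3}
    (hy : f y ≠ 0) : 1 < ‖y‖ ∧ ‖y‖ < 2 :=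
  hfA (subset_tsupport f (mem_support.2 hy))

/-- `Σ_{k<16} φ_k = 1` on the support of a density supported in `A₁`. [folklore] -/
theorem sum_annulusCutoff_eq_one_of_ne_zero (hfA : tsupport f ⊆ {x : E3 | 1 < ‖x‖ ∧ ‖x‖ < 2}) (x : E3)
    (hx : f x ≠ 0) : ∑ k ∈ Finset.range (15 + 1), annulusCutoff k x = 1 := by
  obtain ⟨h1, h2⟩ := mem_annulus_of_mem_tsupport hfA hx
  exact sum_annulusCutoff_eq_one h1.le h2.le

/-- **The `k`-th piece vanishes off the `k`-th sector** (`k ≤ 15`, `tsupp f ⊆ A₁`). [cite: MaoOhTao2023, Lemma 2.2 (proof)] -/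
theorem annulusPiece_eq_zero (hfA : tsupport f ⊆ {x : E3 | 1 < ‖x‖ ∧ ‖x‖ < 2}) {k : ℕ} (hk : k ≤ 15) {y : E3}
    (hy : y ∉ annSector (walkDir k)) : chainPiece annulusCutoff annulusBump 15 f k y = 0 := by
  refine chainPiece_eq_zero_of_notMem annulusCutoff annulusBump 15 f k (V := annSector (walkDir k)) ?_ ?_ ?_ hy
  · intro x hx
    by_contra h
    rcases mul_ne_zero_iff.1 h with ⟨hf, hφ⟩
    have hA := mem_annulus_of_mem_tsupport hfA hf
    have hC : x ∈ dirCone (walkDir k) := tsupport_annulusCutoff_subset k (subset_tsupport _ (mem_support.2 hφ))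
    exact hx (by rw [annSector_eq_inter]; exact ⟨hA, hC⟩)
  · intro hk1 x hx
    refine annulusBump_eq_zero (by omega) hk1 fun h ↦ hx ?_
    have : k + 1 - 1 = k := by omega
    rw [this] at h
    exact h.2
  · intro hk1 x hx
    exact annulusBump_eq_zero hk1 hk fun h ↦ hx h.1

/-- The pieces are supported in `A₁ ⊆ B̄₂`: `f_k(y) ≠ 0 ⟹ y ∈ annSector (walkDir k)`, hence `1 < |y| < 2`.
[cite: MaoOhTao2023, Lemma 2.2 (proof)] -/
theorem mem_annSector_of_annulusPiece_ne_zero (hfA : tsupport f ⊆ {x : E3 | 1 < ‖x‖ ∧ ‖x‖ < 2}) {k : ℕ}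
    (hk : k ≤ 15) {y : E3} (hy : chainPiece annulusCutoff annulusBump 15 f k y ≠ 0) : y ∈ annSector (walkDir k) := by
  by_contra h
  exact hy (annulusPiece_eq_zero hfA hk h)

/-- `f_k(y) ≠ 0 ⟹ |y| ≤ 2`. [folklore] -/
theorem norm_le_two_of_annulusPiece_ne_zero (hfA : tsupport f ⊆ {x : E3 | 1 < ‖x‖ ∧ ‖x‖ < 2}) {k : ℕ}
    (hk : k ≤ 15) (y : E3) (hy : chainPiece annulusCutoff annulusBump 15 f k y ≠ 0) : ‖y‖ ≤ 2 :=
  ((mem_annSector_of_annulusPiece_ne_zero hfA hk hy).2.1).le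

/-- The pieces are continuous (`f` continuous). [folklore] -/
theorem continuous_annulusPiece (hf : Continuous f) (k : ℕ) :
    Continuous (chainPiece annulusCutoff annulusBump 15 f k) :=
  continuous_chainPiece continuous_annulusCutoff continuous_annulusBump 15 hf k

/-- The pieces are `C²` (`f ∈ C²`). [folklore] -/
theorem contDiff_two_annulusPiece (hf : ContDiff ℝ 2 f) (k : ℕ) :
    ContDiff ℝ 2 (chainPiece annulusCutoff annulusBump 15 f k) :=
  contDiff_chainPiece (n := 2) (fun i ↦ contDiff_annulusCutoff (n := 2) i)
    (fun i ↦ contDiff_annulusBump (n := 2) i) 15 hf k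

/-- The pieces have compact support. [folklore] -/
theorem hasCompactSupport_annulusPiece (hfc : HasCompactSupport f) (k : ℕ) :
    HasCompactSupport (chainPiece annulusCutoff annulusBump 15 f k) :=
  hasCompactSupport_chainPiece annulusCutoff hasCompactSupport_annulusBump 15 hfc k

/-- **The pieces of a moment-free density are moment-free** (`k ≤ 15`). [cite: MaoOhTao2023, Lemma 2.2 (proof)] -/
theorem integral_annulusPiece_mul_momentFn (hf : Continuous f) (hfc : HasCompactSupport f)
    (hfA : tsupport f ⊆ {x : E3 | 1 < ‖x‖ ∧ ‖x‖ < 2}) (hmom : ∀ μ, ∫ y : E3, f y * momentFn μ y = 0) {k : ℕ}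
    (hk : k ≤ 15) (μ : Option (Fin 3)) :
    ∫ x : E3, chainPiece annulusCutoff annulusBump 15 f k x * momentFn μ x = 0 :=
  integral_chainPiece_mul_momentFn_eq_zero_of_moments continuous_annulusCutoff continuous_annulusBump
    hasCompactSupport_annulusBump (p := walkPt) (fun i _ _ ↦ annulusBump_walkPt i) hf hfc
    (sum_annulusCutoff_eq_one_of_ne_zero hfA) hmom hk μ

/-- **The pieces sum to `f`** (`tsupp f ⊆ A₁`). [cite: MaoOhTao2023, Lemma 2.2 (proof)] -/
theorem sum_annulusPiece_eq (hfA : tsupport f ⊆ {x : E3 | 1 < ‖x‖ ∧ ‖x‖ < 2}) (x : E3) :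
    ∑ k ∈ Finset.range (15 + 1), chainPiece annulusCutoff annulusBump 15 f k x = f x :=
  sum_chainPiece_eq_self annulusCutoff annulusBump 15 f (sum_annulusCutoff_eq_one_of_ne_zero hfA) x

end Pieces

/-! ### Linearity of `S_η` in the density -/

section Linear

variable {η : E3 → ℝ} {R : ℝ}

/-- **`S_η` is linear** on continuous compactly supported densities. [folklore] -/
theorem bogovskiiS_add_smul (hη : Continuous η) (hR : ∀ z : E3, R < ‖z‖ → η z = 0) {u v : E3 → ℝ}
    (hu : Continuous u) (huc : HasCompactSupport u) (hv : Continuous v) (hvc : HasCompactSupport v) (a b : ℝ)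
    (i j : Fin 3) (x : E3) :
    bogovskiiS η (fun y ↦ a * u y + b * v y) i j x = a * bogovskiiS η u i j x + b * bogovskiiS η v i j x := by
  simp only [bogovskiiS_apply, bogovskiiOperator_eq_translated]
  have Iu := integrable_translated hη hR hu huc x i j
  have Iv := integrable_translated hη hR hv hvc x i j
  rw [← integral_const_mul, ← integral_const_mul, ← integral_add (Iu.const_mul a) (Iv.const_mul b)]
  refine integral_congr_ae (ae_of_all _ fun z ↦ ?_)
  simp only
  ring

end Linear

/-! ### (S1), (S2) and linearity of the annulus operator -/

section Properties

variable {f g : E3 → ℝ}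

/-- Each term of `annulusS` is supported in its sector. [cite: MaoOhTao2023, Lemma 2.2 (S1)] -/
theorem support_term_subset (hfA : tsupport f ⊆ {x : E3 | 1 < ‖x‖ ∧ ‖x‖ < 2}) {k : ℕ} (hk : k ≤ 15) (i j : Fin 3) :
    support (bogovskiiS (kernelBump k) (chainPiece annulusCutoff annulusBump 15 f k) i j) ⊆ annSector (walkDir k) :=
  support_bogovskiiS_subset (starConvex_of_kernelBump k) (fun _ hz ↦ mem_ball_of_kernelBump_ne_zero k hz)
    (fun _ hy ↦ mem_annSector_of_annulusPiece_ne_zero hfA hk hy) i j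

/-- **(S1)**: `supp (S f)^{ij} ⊆ A₁` for `tsupp f ⊆ A₁`. [cite: MaoOhTao2023, Lemma 2.2 (S1)] -/
theorem support_annulusS_subset (hfA : tsupport f ⊆ {x : E3 | 1 < ‖x‖ ∧ ‖x‖ < 2}) (i j : Fin 3) :
    support (annulusS f i j) ⊆ {x : E3 | 1 < ‖x‖ ∧ ‖x‖ < 2} := by
  intro x hx
  rw [mem_support, annulusS] at hx
  obtain ⟨k, hk, hne⟩ := Finset.exists_ne_zero_of_sum_ne_zero hx
  rw [Finset.mem_range] at hk
  exact annSector_subset _ (support_term_subset hfA (by omega) i j (mem_support.2 hne))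

/-- **`S f ∈ C²`** for `f ∈ C²_c`. [cite: MaoOhTao2023, Lemma 2.2] -/
theorem contDiff_two_annulusS (hf : ContDiff ℝ 2 f) (hfc : HasCompactSupport f) (i j : Fin 3) :
    ContDiff ℝ 2 (annulusS f i j) := by
  have h : annulusS f i j = fun x ↦ ∑ k ∈ Finset.range (15 + 1),
      bogovskiiS (kernelBump k) (chainPiece annulusCutoff annulusBump 15 f k) i j x := rfl
  rw [h]
  exact ContDiff.sum fun k _ ↦ contDiff_two_bogovskiiS (contDiff_kernelBump (n := 2) k)
    (kernelBump_eq_zero_of_lt k) (contDiff_two_annulusPiece hf k) (hasCompactSupport_annulusPiece hfc k) i j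

/-- **(S2)**: `Σ_i Σ_j ∂_i∂_j (S f)^{ij} = f` pointwise, for `f ∈ C²_c` with `tsupp f ⊆ A₁` and
`∫ f (1, x₁, x₂, x₃) dx = 0`. [cite: MaoOhTao2023, Lemma 2.2 (S2)] -/
theorem sum_sum_pd_pd_annulusS_eq (hf : ContDiff ℝ 2 f) (hfc : HasCompactSupport f)
    (hfA : tsupport f ⊆ {x : E3 | 1 < ‖x‖ ∧ ‖x‖ < 2}) (hmom : ∀ μ, ∫ y : E3, f y * momentFn μ y = 0) (x : E3) :
    ∑ i, ∑ j, pd i (pd j (annulusS f i j)) x = f x := by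
  set F : ℕ → Fin 3 → Fin 3 → E3 → ℝ := fun k i j ↦
    bogovskiiS (kernelBump k) (chainPiece annulusCutoff annulusBump 15 f k) i j with hF
  have hF2 : ∀ k i j, ContDiff ℝ 2 (F k i j) := fun k i j ↦ contDiff_two_bogovskiiS (contDiff_kernelBump (n := 2) k)
    (kernelBump_eq_zero_of_lt k) (contDiff_two_annulusPiece hf k) (hasCompactSupport_annulusPiece hfc k) i j
  have hF1 : ∀ k i j m, ContDiff ℝ 1 (pd m (F k i j)) := fun k i j m ↦ contDiff_pd (n := 1) (hF2 k i j) m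
  have h1 : ∀ i j, pd j (annulusS f i j) = fun y ↦ ∑ k ∈ Finset.range (15 + 1), pd j (F k i j) y := by
    intro i j
    funext y
    have h : annulusS f i j = fun x ↦ ∑ k ∈ Finset.range (15 + 1), F k i j x := rfl
    rw [h]
    exact pd_sum _ _ fun k _ ↦ ((hF2 k i j).differentiable (by norm_num)) y
  have h2 : ∀ i j, pd i (pd j (annulusS f i j)) x = ∑ k ∈ Finset.range (15 + 1), pd i (pd j (F k i j)) x := by
    intro i j
    rw [h1 i j]
    exact pd_sum _ _ fun k _ ↦ ((hF1 k i j j).differentiable one_ne_zero) x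
  simp only [h2]
  rw [Finset.sum_congr rfl fun i _ ↦ Finset.sum_comm, Finset.sum_comm]
  rw [show ∑ k ∈ Finset.range (15 + 1), ∑ i, ∑ j, pd i (pd j (F k i j)) x =
      ∑ k ∈ Finset.range (15 + 1), chainPiece annulusCutoff annulusBump 15 f k x from
    Finset.sum_congr rfl fun k hk ↦ ?_]
  · exact sum_annulusPiece_eq hfA x
  · rw [Finset.mem_range] at hk
    exact sum_sum_pd_pd_bogovskiiS_eq (contDiff_kernelBump (n := 2) k) (kernelBump_eq_zero_of_lt k)
      (integral_kernelBump k) (contDiff_two_annulusPiece hf k) (hasCompactSupport_annulusPiece hfc k)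
      (fun μ ↦ integral_annulusPiece_mul_momentFn hf.continuous hfc hfA hmom (by omega) μ) x

/-- **Linearity**: `S(a f + b g) = a S f + b S g` for continuous compactly supported `f, g`.
[cite: MaoOhTao2023, Lemma 2.2] -/
theorem annulusS_add_smul (hf : Continuous f) (hfc : HasCompactSupport f) (hg : Continuous g)
    (hgc : HasCompactSupport g) (a b : ℝ) (i j : Fin 3) (x : E3) :
    annulusS (fun y ↦ a * f y + b * g y) i j x = a * annulusS f i j x + b * annulusS g i j x := by
  simp only [annulusS, Finset.mul_sum, ← Finset.sum_add_distrib]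
  refine Finset.sum_congr rfl fun k _ ↦ ?_
  have hp : chainPiece annulusCutoff annulusBump 15 (fun y ↦ a * f y + b * g y) k =
      fun y ↦ a * chainPiece annulusCutoff annulusBump 15 f k y + b * chainPiece annulusCutoff annulusBump 15 g k y :=
    funext fun y ↦ chainPiece_add_smul continuous_annulusCutoff annulusBump 15 hf hfc hg hgc a b k y
  rw [hp]
  exact bogovskiiS_add_smul (contDiff_kernelBump (n := 0) k).continuous (kernelBump_eq_zero_of_lt k)
    (continuous_annulusPiece hf k) (hasCompactSupport_annulusPiece hfc k) (continuous_annulusPiece hg k)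
    (hasCompactSupport_annulusPiece hgc k) a b i j x

end Properties


/-! ### `L²` bounds for the pieces -/

section PieceBounds

variable {f : E3 → ℝ}

/-- **Cauchy–Schwarz for the localised moments**: for `|φ| ≤ 1` and `f` continuous vanishing off `B̄_ρ`,
`‖∫ f φ g_μ‖² ≤ (∫_{B̄_ρ} |g_μ|²) ∫ |f|²`. [folklore] -/
theorem enorm_moment_sq_le {φ : E3 → ℝ} (hf : Continuous f) (hφ1 : ∀ x, |φ x| ≤ 1) {ρ : ℝ}
    (hfρ : ∀ y, f y ≠ 0 → ‖y‖ ≤ ρ) (μ : Option (Fin 3)) :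
    ‖∫ y : E3, f y * φ y * momentFn μ y‖ₑ ^ (2 : ℝ) ≤
      (∫⁻ y in closedBall (0 : E3) ρ, ‖momentFn μ y‖ₑ ^ (2 : ℝ)) * ∫⁻ y : E3, ‖f y‖ₑ ^ (2 : ℝ) := by
  set K : E3 → ℝ≥0∞ := (closedBall (0 : E3) ρ).indicator fun y ↦ ‖momentFn μ y‖ₑ with hK
  have hKm : Measurable K := (continuous_momentFn μ).measurable.enorm.indicator measurableSet_closedBall
  have hFm : Measurable fun y : E3 ↦ ‖f y‖ₑ := hf.measurable.enorm
  have hpt : ∀ y, ‖f y * φ y * momentFn μ y‖ₑ ≤ ‖f y‖ₑ * K y := by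
    intro y
    by_cases hy : f y = 0
    · simp [hy]
    · have hmem : y ∈ closedBall (0 : E3) ρ := by rw [mem_closedBall, dist_zero_right]; exact hfρ y hy
      rw [hK, indicator_of_mem hmem, enorm_mul, enorm_mul]
      have h1 : ‖φ y‖ₑ ≤ 1 := by
        rw [Real.enorm_eq_ofReal_abs]; exact ENNReal.ofReal_le_one.2 (hφ1 y)
      calc ‖f y‖ₑ * ‖φ y‖ₑ * ‖momentFn μ y‖ₑ ≤ ‖f y‖ₑ * 1 * ‖momentFn μ y‖ₑ := by gcongr
        _ = _ := by rw [mul_one]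
  have h1 : ‖∫ y : E3, f y * φ y * momentFn μ y‖ₑ ≤ ∫⁻ y, ‖f y‖ₑ * K y :=
    (enorm_integral_le_lintegral_enorm _).trans (lintegral_mono hpt)
  have hCS := ENNReal.lintegral_mul_le_Lp_mul_Lq volume Real.HolderConjugate.two_two hFm.aemeasurable hKm.aemeasurable
  have hK2 : ∫⁻ y, K y ^ (2 : ℝ) = ∫⁻ y in closedBall (0 : E3) ρ, ‖momentFn μ y‖ₑ ^ (2 : ℝ) := by
    rw [← lintegral_indicator measurableSet_closedBall]
    refine lintegral_congr fun y ↦ ?_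
    by_cases hy : y ∈ closedBall (0 : E3) ρ
    · rw [hK, indicator_of_mem hy, indicator_of_mem hy]
    · rw [hK, indicator_of_notMem hy, indicator_of_notMem hy, ENNReal.zero_rpow_of_pos (by norm_num)]
  calc ‖∫ y : E3, f y * φ y * momentFn μ y‖ₑ ^ (2 : ℝ) ≤ (∫⁻ y, ‖f y‖ₑ * K y) ^ (2 : ℝ) :=
        ENNReal.rpow_le_rpow h1 (by norm_num)
    _ ≤ ((∫⁻ y, ‖f y‖ₑ ^ (2 : ℝ)) ^ (1 / (2 : ℝ)) * (∫⁻ y, K y ^ (2 : ℝ)) ^ (1 / (2 : ℝ))) ^ (2 : ℝ) :=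
        ENNReal.rpow_le_rpow hCS (by norm_num)
    _ = (∫⁻ y, ‖f y‖ₑ ^ (2 : ℝ)) * ∫⁻ y, K y ^ (2 : ℝ) := by
        rw [ENNReal.mul_rpow_of_nonneg _ _ (by norm_num), ← ENNReal.rpow_mul, ← ENNReal.rpow_mul]
        norm_num
    _ = _ := by rw [hK2, mul_comm]

/-- The moment weights `P_μ(ρ) = ∫_{B̄_ρ} |g_μ|²` are finite. [folklore] -/
theorem lintegral_momentFn_sq_lt_top (ρ : ℝ) (μ : Option (Fin 3)) :
    ∫⁻ y in closedBall (0 : E3) ρ, ‖momentFn μ y‖ₑ ^ (2 : ℝ) < ⊤ := by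
  obtain ⟨C, hC⟩ := (isCompact_closedBall (0 : E3) ρ).exists_bound_of_continuousOn
    (f := fun y : E3 ↦ momentFn μ y) (continuous_momentFn μ).continuousOn
  refine (setLIntegral_lt_top_of_le_nnreal measure_closedBall_lt_top.ne ⟨⟨C ^ 2, by positivity⟩, fun y hy ↦ ?_⟩)
  have h := hC y hy
  have hC0 : 0 ≤ C := (norm_nonneg _).trans h
  rw [← enorm_norm, Real.enorm_eq_ofReal (norm_nonneg _), ENNReal.ofReal_rpow_of_nonneg (norm_nonneg _) (by norm_num),
    ENNReal.ofReal_le_iff_le_toReal ENNReal.coe_ne_top]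
  · simp only [ENNReal.coe_toReal, Real.rpow_two]
    exact pow_le_pow_left₀ (norm_nonneg _) h 2

/-- `(Σ_{i ∈ s} a_i)² ≤ |s| Σ a_i²` in `ℝ≥0∞`. [folklore] -/
theorem enorm_finset_sum_sq_le {ι : Type*} (s : Finset ι) (a : ι → ℝ≥0∞) :
    (∑ i ∈ s, a i) ^ (2 : ℝ) ≤ s.card * ∑ i ∈ s, a i ^ (2 : ℝ) := by
  have h := ENNReal.rpow_sum_le_const_mul_sum_rpow s a (p := 2) (by norm_num)
  convert h using 2; norm_num

/-- **Bound for the tail moments**: `‖M_k^μ‖² ≤ 16 · 16 · P_μ(2) ∫|f|²` for `f` continuous with `tsupp f ⊆ A₁`.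
[folklore] -/
theorem enorm_chainMoment_sq_le (hf : Continuous f) (hfA : tsupport f ⊆ {x : E3 | 1 < ‖x‖ ∧ ‖x‖ < 2}) (k : ℕ)
    (μ : Option (Fin 3)) :
    ‖chainMoment annulusCutoff 15 f k μ‖ₑ ^ (2 : ℝ) ≤
      16 * (16 * ((∫⁻ y in closedBall (0 : E3) 2, ‖momentFn μ y‖ₑ ^ (2 : ℝ)) * ∫⁻ y : E3, ‖f y‖ₑ ^ (2 : ℝ))) := by
  have hfρ : ∀ y, f y ≠ 0 → ‖y‖ ≤ 2 := fun y hy ↦ (mem_annulus_of_mem_tsupport hfA hy).2.le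
  set P : ℝ≥0∞ := (∫⁻ y in closedBall (0 : E3) 2, ‖momentFn μ y‖ₑ ^ (2 : ℝ)) * ∫⁻ y : E3, ‖f y‖ₑ ^ (2 : ℝ) with hP
  have hm : ∀ i, ‖∫ y : E3, f y * annulusCutoff i y * momentFn μ y‖ₑ ^ (2 : ℝ) ≤ P := fun i ↦
    enorm_moment_sq_le hf (abs_annulusCutoff_le i) hfρ μ
  have hsub : Finset.Icc k 15 ⊆ Finset.range 16 := fun i hi ↦ by
    rw [Finset.mem_Icc] at hi; rw [Finset.mem_range]; omega
  calc ‖chainMoment annulusCutoff 15 f k μ‖ₑ ^ (2 : ℝ)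
      ≤ (∑ i ∈ Finset.Icc k 15, ‖∫ y : E3, f y * annulusCutoff i y * momentFn μ y‖ₑ) ^ (2 : ℝ) := by
        rw [chainMoment]
        exact ENNReal.rpow_le_rpow (enorm_sum_le _ _) (by norm_num)
    _ ≤ (∑ i ∈ Finset.range 16, ‖∫ y : E3, f y * annulusCutoff i y * momentFn μ y‖ₑ) ^ (2 : ℝ) :=
        ENNReal.rpow_le_rpow (Finset.sum_le_sum_of_subset hsub) (by norm_num)
    _ ≤ (Finset.range 16).card * ∑ i ∈ Finset.range 16,
          ‖∫ y : E3, f y * annulusCutoff i y * momentFn μ y‖ₑ ^ (2 : ℝ) := enorm_finset_sum_sq_le _ _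
    _ ≤ (16 : ℕ) * ∑ _i ∈ Finset.range 16, P := by
        rw [Finset.card_range]
        gcongr with i
        exact hm i
    _ = 16 * (16 * P) := by
        rw [Finset.sum_const, Finset.card_range, nsmul_eq_mul]; push_cast; ring

/-- **`L²` bound of a correction sum**: `∫ |Σ_μ c_μ θ^μ[ζ]|² ≤ 4 Σ_μ ‖c_μ‖² ∫ |θ^μ[ζ]|²` (`ζ` continuous). [folklore] -/
theorem lintegral_sum_mul_theta_sq_le {ζ : E3 → ℝ} (hζ : Continuous ζ) (c : Option (Fin 3) → ℝ) :
    ∫⁻ x : E3, ‖∑ μ, c μ * theta ζ μ x‖ₑ ^ (2 : ℝ) ≤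
      4 * ∑ μ, ‖c μ‖ₑ ^ (2 : ℝ) * ∫⁻ x : E3, ‖theta ζ μ x‖ₑ ^ (2 : ℝ) := by
  have hmeas : ∀ μ, Measurable fun x : E3 ↦ ‖c μ‖ₑ ^ (2 : ℝ) * ‖theta ζ μ x‖ₑ ^ (2 : ℝ) := fun μ ↦
    ((continuous_theta hζ μ).measurable.enorm.pow_const _).const_mul _
  have hpt : ∀ x, ‖∑ μ, c μ * theta ζ μ x‖ₑ ^ (2 : ℝ) ≤ 4 * ∑ μ, ‖c μ‖ₑ ^ (2 : ℝ) * ‖theta ζ μ x‖ₑ ^ (2 : ℝ) := by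
    intro x
    calc ‖∑ μ, c μ * theta ζ μ x‖ₑ ^ (2 : ℝ) ≤ (∑ μ, ‖c μ * theta ζ μ x‖ₑ) ^ (2 : ℝ) :=
          ENNReal.rpow_le_rpow (enorm_sum_le _ _) (by norm_num)
      _ ≤ (Finset.univ : Finset (Option (Fin 3))).card * ∑ μ, ‖c μ * theta ζ μ x‖ₑ ^ (2 : ℝ) :=
          enorm_finset_sum_sq_le _ _
      _ = 4 * ∑ μ, ‖c μ‖ₑ ^ (2 : ℝ) * ‖theta ζ μ x‖ₑ ^ (2 : ℝ) := by
          have hcard : (((Finset.univ : Finset (Option (Fin 3))).card : ℕ) : ℝ≥0∞) = 4 := by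
            norm_num [Finset.card_univ, Fintype.card_option, Fintype.card_fin]
          rw [hcard]
          congr 1
          exact Finset.sum_congr rfl fun μ _ ↦ by rw [enorm_mul, ENNReal.mul_rpow_of_nonneg _ _ (by norm_num)]
  calc ∫⁻ x : E3, ‖∑ μ, c μ * theta ζ μ x‖ₑ ^ (2 : ℝ)
      ≤ ∫⁻ x : E3, 4 * ∑ μ, ‖c μ‖ₑ ^ (2 : ℝ) * ‖theta ζ μ x‖ₑ ^ (2 : ℝ) := lintegral_mono hpt
    _ = 4 * ∑ μ, ‖c μ‖ₑ ^ (2 : ℝ) * ∫⁻ x : E3, ‖theta ζ μ x‖ₑ ^ (2 : ℝ) := by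
        rw [lintegral_const_mul' _ _ (by norm_num), lintegral_finsetSum _ fun μ _ ↦ hmeas μ]
        congr 1
        refine Finset.sum_congr rfl fun μ _ ↦ ?_
        rw [lintegral_const_mul' _ _ (ENNReal.rpow_ne_top_of_nonneg (by norm_num) enorm_ne_top)]

/-- The `θ`-weights `∫ |θ^μ[η_k]|²` are finite. [folklore] -/
theorem lintegral_theta_annulusBump_sq_lt_top (k : ℕ) (μ : Option (Fin 3)) :
    ∫⁻ x : E3, ‖theta (annulusBump k) μ x‖ₑ ^ (2 : ℝ) < ⊤ := by
  have hc : Continuous (theta (annulusBump k) μ) := continuous_theta (continuous_annulusBump k) μ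
  have hm : MemLp (theta (annulusBump k) μ) 2 volume :=
    hc.memLp_of_hasCompactSupport (hasCompactSupport_theta (hasCompactSupport_annulusBump k) μ)
  rw [lintegral_enorm_sq_eq_eLpNorm_sq]
  exact ENNReal.rpow_lt_top_of_nonneg (by norm_num) hm.eLpNorm_lt_top.ne

/-- **Uniform `L²` bound for the pieces**: there is `C < ∞` with `∫ |f_k|² ≤ C ∫ |f|²` for all continuous `f` with
`tsupp f ⊆ A₁` and all `k ≤ 15`. [cite: MaoOhTao2023, Lemma 2.2 (proof)] -/
theorem exists_l2Const_annulusPiece :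
    ∃ C : ℝ≥0∞, C < ⊤ ∧ ∀ f : E3 → ℝ, Continuous f → tsupport f ⊆ {x : E3 | 1 < ‖x‖ ∧ ‖x‖ < 2} →
      ∀ k ≤ 15, ∫⁻ x : E3, ‖chainPiece annulusCutoff annulusBump 15 f k x‖ₑ ^ (2 : ℝ) ≤
        C * ∫⁻ y : E3, ‖f y‖ₑ ^ (2 : ℝ) := by
  -- uniform finite weights
  set Pm : ℝ≥0∞ := ∑ μ, ∫⁻ y in closedBall (0 : E3) 2, ‖momentFn μ y‖ₑ ^ (2 : ℝ) with hPm
  have hPmtop : Pm < ⊤ := ENNReal.sum_lt_top.2 fun μ _ ↦ lintegral_momentFn_sq_lt_top 2 μ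
  have hPle : ∀ μ, (∫⁻ y in closedBall (0 : E3) 2, ‖momentFn μ y‖ₑ ^ (2 : ℝ)) ≤ Pm := fun μ ↦
    Finset.single_le_sum (f := fun μ ↦ ∫⁻ y in closedBall (0 : E3) 2, ‖momentFn μ y‖ₑ ^ (2 : ℝ))
      (fun _ _ ↦ by positivity) (Finset.mem_univ μ)
  set Th : ℝ≥0∞ := ∑ k ∈ Finset.range 17, ∑ μ, ∫⁻ x : E3, ‖theta (annulusBump k) μ x‖ₑ ^ (2 : ℝ) with hTh
  have hThtop : Th < ⊤ := ENNReal.sum_lt_top.2 fun k _ ↦ ENNReal.sum_lt_top.2 fun μ _ ↦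
    lintegral_theta_annulusBump_sq_lt_top k μ
  have hThle : ∀ k ≤ 16, ∀ μ, ∫⁻ x : E3, ‖theta (annulusBump k) μ x‖ₑ ^ (2 : ℝ) ≤ Th := by
    intro k hk μ
    calc ∫⁻ x : E3, ‖theta (annulusBump k) μ x‖ₑ ^ (2 : ℝ)
        ≤ ∑ μ, ∫⁻ x : E3, ‖theta (annulusBump k) μ x‖ₑ ^ (2 : ℝ) :=
          Finset.single_le_sum (f := fun μ ↦ ∫⁻ x : E3, ‖theta (annulusBump k) μ x‖ₑ ^ (2 : ℝ))
            (fun _ _ ↦ by positivity) (Finset.mem_univ μ)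
      _ ≤ Th := Finset.single_le_sum (f := fun k ↦ ∑ μ, ∫⁻ x : E3, ‖theta (annulusBump k) μ x‖ₑ ^ (2 : ℝ))
            (fun _ _ ↦ by positivity) (Finset.mem_range.2 (by omega))
  -- the correction-sum bound, uniformly
  set W : ℝ≥0∞ := 4 * (4 * (16 * (16 * Pm)) * Th) with hW
  have hWtop : W < ⊤ := by
    refine ENNReal.mul_lt_top (by norm_num) (ENNReal.mul_lt_top (ENNReal.mul_lt_top (by norm_num)
      (ENNReal.mul_lt_top (by norm_num) (ENNReal.mul_lt_top (by norm_num) hPmtop))) hThtop)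
  refine ⟨3 * (1 + W + W), ENNReal.mul_lt_top (by norm_num)
    (ENNReal.add_lt_top.2 ⟨ENNReal.add_lt_top.2 ⟨ENNReal.one_lt_top, hWtop⟩, hWtop⟩), ?_⟩
  intro f hf hfA k hk
  set G : ℝ≥0∞ := ∫⁻ y : E3, ‖f y‖ₑ ^ (2 : ℝ) with hG
  have hM : ∀ k' μ, ‖chainMoment annulusCutoff 15 f k' μ‖ₑ ^ (2 : ℝ) ≤ 16 * (16 * Pm) * G := by
    intro k' μ
    calc _ ≤ _ := enorm_chainMoment_sq_le hf hfA k' μ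
      _ ≤ 16 * (16 * (Pm * G)) := by gcongr; exact hPle μ
      _ = _ := by ring
  have hcorr : ∀ k' ≤ 16, ∫⁻ x : E3, ‖∑ μ, chainMoment annulusCutoff 15 f k' μ * theta (annulusBump k') μ x‖ₑ ^ (2 : ℝ) ≤
      W * G := by
    intro k' hk'
    calc _ ≤ 4 * ∑ μ, ‖chainMoment annulusCutoff 15 f k' μ‖ₑ ^ (2 : ℝ) *
          ∫⁻ x : E3, ‖theta (annulusBump k') μ x‖ₑ ^ (2 : ℝ) := lintegral_sum_mul_theta_sq_le (continuous_annulusBump k') _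
      _ ≤ 4 * ∑ _μ : Option (Fin 3), (16 * (16 * Pm) * G) * Th := by
          gcongr with μ
          · exact hM k' μ
          · exact hThle k' hk' μ
      _ = W * G := by
          rw [Finset.sum_const, Finset.card_univ, Fintype.card_option, Fintype.card_fin, nsmul_eq_mul, hW]
          push_cast; ring
  -- pointwise splitting of the piece
  set A : E3 → ℝ := fun x ↦ if k + 1 ≤ 15 then ∑ μ, chainMoment annulusCutoff 15 f (k + 1) μ *
    theta (annulusBump (k + 1)) μ x else 0 with hA
  set B : E3 → ℝ := fun x ↦ if 1 ≤ k then ∑ μ, chainMoment annulusCutoff 15 f k μ * theta (annulusBump k) μ x else 0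
    with hB
  have hpiece : ∀ x, chainPiece annulusCutoff annulusBump 15 f k x = f x * annulusCutoff k x + A x - B x := by
    intro x; simp only [chainPiece, hA, hB]
  have hpt : ∀ x, ‖chainPiece annulusCutoff annulusBump 15 f k x‖ₑ ^ (2 : ℝ) ≤
      3 * (‖f x‖ₑ ^ (2 : ℝ) + ‖A x‖ₑ ^ (2 : ℝ) + ‖B x‖ₑ ^ (2 : ℝ)) := by
    intro x
    rw [hpiece x]
    have h1 : ‖f x * annulusCutoff k x‖ₑ ≤ ‖f x‖ₑ := by
      rw [enorm_mul]
      have : ‖annulusCutoff k x‖ₑ ≤ 1 := by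
        rw [Real.enorm_eq_ofReal_abs]; exact ENNReal.ofReal_le_one.2 (abs_annulusCutoff_le k x)
      calc ‖f x‖ₑ * ‖annulusCutoff k x‖ₑ ≤ ‖f x‖ₑ * 1 := by gcongr
        _ = _ := mul_one _
    calc ‖f x * annulusCutoff k x + A x - B x‖ₑ ^ (2 : ℝ) ≤ (‖f x‖ₑ + ‖A x‖ₑ + ‖B x‖ₑ) ^ (2 : ℝ) := by
          refine ENNReal.rpow_le_rpow ?_ (by norm_num)
          calc ‖f x * annulusCutoff k x + A x - B x‖ₑ ≤ ‖f x * annulusCutoff k x + A x‖ₑ + ‖B x‖ₑ := enorm_sub_le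
            _ ≤ ‖f x * annulusCutoff k x‖ₑ + ‖A x‖ₑ + ‖B x‖ₑ := by gcongr; exact enorm_add_le _ _
            _ ≤ _ := by gcongr
      _ ≤ _ := by
          have h := enorm_sum_three_sq_le ![‖f x‖ₑ, ‖A x‖ₑ, ‖B x‖ₑ]
          simp only [Fin.sum_univ_three, Matrix.cons_val_zero, Matrix.cons_val_one, Matrix.cons_val] at h
          exact h
  have hAm : Measurable fun x ↦ ‖A x‖ₑ ^ (2 : ℝ) := by
    refine (Measurable.enorm ?_).pow_const _
    simp only [hA]
    split_ifs
    · exact (continuous_finsetSum _ fun μ _ ↦ continuous_const.mul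
        (continuous_theta (continuous_annulusBump _) μ)).measurable
    · exact measurable_const
  have hfm : Measurable fun x ↦ ‖f x‖ₑ ^ (2 : ℝ) := hf.measurable.enorm.pow_const _
  have hAint : ∫⁻ x, ‖A x‖ₑ ^ (2 : ℝ) ≤ W * G := by
    simp only [hA]
    split_ifs with h
    · exact hcorr (k + 1) (by omega)
    · simp
  have hBint : ∫⁻ x, ‖B x‖ₑ ^ (2 : ℝ) ≤ W * G := by
    simp only [hB]
    split_ifs with h
    · exact hcorr k (by omega)
    · simp
  have hfAm : Measurable fun x ↦ ‖f x‖ₑ ^ (2 : ℝ) + ‖A x‖ₑ ^ (2 : ℝ) := hfm.add hAm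
  calc ∫⁻ x : E3, ‖chainPiece annulusCutoff annulusBump 15 f k x‖ₑ ^ (2 : ℝ)
      ≤ ∫⁻ x, 3 * (‖f x‖ₑ ^ (2 : ℝ) + ‖A x‖ₑ ^ (2 : ℝ) + ‖B x‖ₑ ^ (2 : ℝ)) := lintegral_mono hpt
    _ = 3 * (G + (∫⁻ x, ‖A x‖ₑ ^ (2 : ℝ)) + ∫⁻ x, ‖B x‖ₑ ^ (2 : ℝ)) := by
        rw [lintegral_const_mul' _ _ (by norm_num), lintegral_add_left hfAm, lintegral_add_left hfm]
    _ ≤ 3 * (1 * G + W * G + W * G) := by rw [one_mul]; gcongr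
    _ = 3 * (1 + W + W) * G := by ring

end PieceBounds


/-! ### (S3) at the `L²` level: `L²`, `Ḣ¹` and `Ḣ²` bounds of the annulus operator -/

section OperatorBounds

/-- `∫ |Σ_{k ∈ s} u_k|² ≤ |s| Σ_{k ∈ s} ∫ |u_k|²` for measurable `u_k`. [folklore] -/
theorem lintegral_enorm_sum_sq_le {ι : Type*} (s : Finset ι) {u : ι → E3 → ℝ} (hu : ∀ k ∈ s, Measurable (u k)) :
    ∫⁻ x : E3, ‖∑ k ∈ s, u k x‖ₑ ^ (2 : ℝ) ≤ s.card * ∑ k ∈ s, ∫⁻ x : E3, ‖u k x‖ₑ ^ (2 : ℝ) := by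
  calc ∫⁻ x : E3, ‖∑ k ∈ s, u k x‖ₑ ^ (2 : ℝ) ≤ ∫⁻ x : E3, s.card * ∑ k ∈ s, ‖u k x‖ₑ ^ (2 : ℝ) := by
        refine lintegral_mono fun x ↦ ?_
        exact (ENNReal.rpow_le_rpow (enorm_sum_le _ _) (by norm_num)).trans (enorm_finset_sum_sq_le _ _)
    _ = s.card * ∑ k ∈ s, ∫⁻ x : E3, ‖u k x‖ₑ ^ (2 : ℝ) := by
        rw [lintegral_const_mul' _ _ (by simp), lintegral_finsetSum _ fun k hk ↦ (hu k hk).enorm.pow_const _]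

/-- **Lemma 2.2, (S3) at the `L²` level**: there is `C < ∞` such that for every `f ∈ C²_c` with `tsupp f ⊆ A₁` and all
`i, j, a, b`: `∫ |(S f)^{ij}|², ∫ |∂_a (S f)^{ij}|², ∫ |∂_a∂_b (S f)^{ij}|² ≤ C ∫ |f|²` — the linear operator `S` of
the annulus maps `L²(A₁)` boundedly into `H²` (the paper's `‖S f‖_{H^{s'}} ≲ ‖f‖_{H^{s'-2}}` at `s' = 2`, on the dense
class `C²_c(A₁)`). [cite: MaoOhTao2023, Lemma 2.2 (S3)] -/
theorem exists_sobolevConst_annulusS :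
    ∃ C : ℝ≥0∞, C < ⊤ ∧ ∀ f : E3 → ℝ, ContDiff ℝ 2 f → HasCompactSupport f →
      tsupport f ⊆ {x : E3 | 1 < ‖x‖ ∧ ‖x‖ < 2} → ∀ i j : Fin 3,
        (∫⁻ x : E3, ‖annulusS f i j x‖ₑ ^ (2 : ℝ) ≤ C * ∫⁻ y : E3, ‖f y‖ₑ ^ (2 : ℝ)) ∧
        (∀ a : Fin 3, ∫⁻ x : E3, ‖pd a (annulusS f i j) x‖ₑ ^ (2 : ℝ) ≤ C * ∫⁻ y : E3, ‖f y‖ₑ ^ (2 : ℝ)) ∧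
        ∀ a b : Fin 3, ∫⁻ x : E3, ‖pd a (pd b (annulusS f i j)) x‖ₑ ^ (2 : ℝ) ≤ C * ∫⁻ y : E3, ‖f y‖ₑ ^ (2 : ℝ) := by
  -- per-sector constants
  have h0 : ∀ k : ℕ, ∃ C : ℝ≥0∞, C < ⊤ ∧ ∀ (u : E3 → ℝ), Continuous u → (∀ y, u y ≠ 0 → ‖y‖ ≤ 2) → ∀ i j : Fin 3,
      ∫⁻ x : E3, ‖bogovskiiS (kernelBump k) u i j x‖ₑ ^ (2 : ℝ) ≤ C * ∫⁻ y : E3, ‖u y‖ₑ ^ (2 : ℝ) := fun k ↦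
    exists_l2Const_bogovskiiS (contDiff_kernelBump (n := 0) k).continuous (kernelBump_eq_zero_of_lt k) 2
  have h1 : ∀ k : ℕ, ∃ C : ℝ≥0∞, C < ⊤ ∧ ∀ (u : E3 → ℝ), ContDiff ℝ 1 u → HasCompactSupport u →
      (∀ y, u y ≠ 0 → ‖y‖ ≤ 2) → ∀ i j m : Fin 3,
        ∫⁻ x : E3, ‖pd m (bogovskiiS (kernelBump k) u i j) x‖ₑ ^ (2 : ℝ) ≤ C * ∫⁻ y : E3, ‖u y‖ₑ ^ (2 : ℝ) := fun k ↦
    exists_h1Const_bogovskiiS (contDiff_kernelBump (n := 1) k) (kernelBump_eq_zero_of_lt k) (ρ := 2) (by norm_num)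
  have h2 : ∀ k : ℕ, ∃ C : ℝ≥0∞, C < ⊤ ∧ ∀ (u : E3 → ℝ), ContDiff ℝ 2 u → HasCompactSupport u →
      (∀ y, u y ≠ 0 → ‖y‖ ≤ 2) → ∀ i j a b : Fin 3,
        ∫⁻ x : E3, ‖pd a (pd b (bogovskiiS (kernelBump k) u i j)) x‖ₑ ^ (2 : ℝ) ≤ C * ∫⁻ y : E3, ‖u y‖ₑ ^ (2 : ℝ) :=
    fun k ↦ exists_h2Const_bogovskiiS (contDiff_kernelBump (n := 7) k) (kernelBump_eq_zero_of_lt k) 2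
  choose C0 hC0 hB0 using h0
  choose C1 hC1 hB1 using h1
  choose C2 hC2 hB2 using h2
  obtain ⟨CP, hCP, hP⟩ := exists_l2Const_annulusPiece
  set K : ℝ≥0∞ := ∑ k ∈ Finset.range (15 + 1), (C0 k + C1 k + C2 k) with hK
  have hKtop : K < ⊤ := ENNReal.sum_lt_top.2 fun k _ ↦
    ENNReal.add_lt_top.2 ⟨ENNReal.add_lt_top.2 ⟨hC0 k, hC1 k⟩, hC2 k⟩
  have hKle : ∀ k ∈ Finset.range (15 + 1), C0 k ≤ K ∧ C1 k ≤ K ∧ C2 k ≤ K := by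
    intro k hk
    have h : C0 k + C1 k + C2 k ≤ K :=
      Finset.single_le_sum (f := fun k ↦ C0 k + C1 k + C2 k) (fun _ _ ↦ by positivity) hk
    exact ⟨le_self_add.trans (le_self_add.trans h), (le_add_self.trans le_self_add).trans h, le_add_self.trans h⟩
  refine ⟨16 * (16 * (K * CP)), ENNReal.mul_lt_top (by norm_num) (ENNReal.mul_lt_top (by norm_num)
    (ENNReal.mul_lt_top hKtop hCP)), ?_⟩
  intro f hf hfc hfA i j
  have hfcn : Continuous f := hf.continuous
  set G : ℝ≥0∞ := ∫⁻ y : E3, ‖f y‖ₑ ^ (2 : ℝ) with hG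
  set p : ℕ → E3 → ℝ := fun k ↦ chainPiece annulusCutoff annulusBump 15 f k with hp
  have hp2 : ∀ k, ContDiff ℝ 2 (p k) := fun k ↦ contDiff_two_annulusPiece hf k
  have hp1 : ∀ k, ContDiff ℝ 1 (p k) := fun k ↦ (hp2 k).of_le (by norm_cast)
  have hpc : ∀ k, HasCompactSupport (p k) := fun k ↦ hasCompactSupport_annulusPiece hfc k
  have hpρ : ∀ k ∈ Finset.range (15 + 1), ∀ y, p k y ≠ 0 → ‖y‖ ≤ 2 := fun k hk y hy ↦
    norm_le_two_of_annulusPiece_ne_zero hfA (by rw [Finset.mem_range] at hk; omega) y hy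
  have hPk : ∀ k ∈ Finset.range (15 + 1), ∫⁻ y, ‖p k y‖ₑ ^ (2 : ℝ) ≤ CP * G := fun k hk ↦
    hP f hfcn hfA k (by rw [Finset.mem_range] at hk; omega)
  set u : ℕ → E3 → ℝ := fun k ↦ bogovskiiS (kernelBump k) (p k) i j with hu
  have hu2 : ∀ k, ContDiff ℝ 2 (u k) := fun k ↦ contDiff_two_bogovskiiS (contDiff_kernelBump (n := 2) k)
    (kernelBump_eq_zero_of_lt k) (hp2 k) (hpc k) i j
  have hu1 : ∀ k m, ContDiff ℝ 1 (pd m (u k)) := fun k m ↦ contDiff_pd (n := 1) (hu2 k) m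
  have hu0 : ∀ k a b, ContDiff ℝ 0 (pd a (pd b (u k))) := fun k a b ↦ contDiff_pd (n := 0) (hu1 k b) a
  have hS : annulusS f i j = fun x ↦ ∑ k ∈ Finset.range (15 + 1), u k x := rfl
  have hdS : ∀ b, pd b (annulusS f i j) = fun x ↦ ∑ k ∈ Finset.range (15 + 1), pd b (u k) x := by
    intro b; funext x
    rw [hS]
    exact pd_sum _ _ fun k _ ↦ ((hu2 k).differentiable (by norm_num)) x
  have hddS : ∀ a b, pd a (pd b (annulusS f i j)) = fun x ↦ ∑ k ∈ Finset.range (15 + 1), pd a (pd b (u k)) x := by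
    intro a b; funext x
    rw [hdS b]
    exact pd_sum _ _ fun k _ ↦ ((hu1 k b).differentiable one_ne_zero) x
  -- the common summation step
  have hstep : ∀ (v : ℕ → E3 → ℝ), (∀ k, Measurable (v k)) →
      (∀ k ∈ Finset.range (15 + 1), ∫⁻ x, ‖v k x‖ₑ ^ (2 : ℝ) ≤ K * ∫⁻ y, ‖p k y‖ₑ ^ (2 : ℝ)) →
      ∫⁻ x : E3, ‖∑ k ∈ Finset.range (15 + 1), v k x‖ₑ ^ (2 : ℝ) ≤ 16 * (16 * (K * CP)) * G := by
    intro v hvm hvb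
    calc ∫⁻ x : E3, ‖∑ k ∈ Finset.range (15 + 1), v k x‖ₑ ^ (2 : ℝ)
        ≤ (Finset.range (15 + 1)).card * ∑ k ∈ Finset.range (15 + 1), ∫⁻ x, ‖v k x‖ₑ ^ (2 : ℝ) :=
          lintegral_enorm_sum_sq_le _ fun k _ ↦ hvm k
      _ ≤ (Finset.range (15 + 1)).card * ∑ k ∈ Finset.range (15 + 1), K * (CP * G) := by
          gcongr with k hk
          exact (hvb k hk).trans (by gcongr; exact hPk k hk)
      _ = 16 * (16 * (K * CP)) * G := by
          rw [Finset.sum_const, Finset.card_range, nsmul_eq_mul]; push_cast; ring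
  refine ⟨?_, fun a ↦ ?_, fun a b ↦ ?_⟩
  · rw [hS]
    refine hstep u (fun k ↦ (hu2 k).continuous.measurable) fun k hk ↦ ?_
    exact (hB0 k (p k) (hp2 k).continuous (hpρ k hk) i j).trans (by gcongr; exact (hKle k hk).1)
  · rw [hdS a]
    refine hstep (fun k ↦ pd a (u k)) (fun k ↦ (hu1 k a).continuous.measurable) fun k hk ↦ ?_
    exact (hB1 k (p k) (hp1 k) (hpc k) (hpρ k hk) i j a).trans (by gcongr; exact (hKle k hk).2.1)
  · rw [hddS a b]
    refine hstep (fun k ↦ pd a (pd b (u k))) (fun k ↦ (hu0 k a b).continuous.measurable) fun k hk ↦ ?_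
    exact (hB2 k (p k) (hp2 k) (hpc k) (hpρ k hk) i j a b).trans (by gcongr; exact (hKle k hk).2.2)

end OperatorBounds

end MaoOhTao

end Literature.Geometry.Lorentzian
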